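import Summits.Ventures.QEC.CircuitDistance.ETowerAssembly
import HarnessLib

/-!
# P3-PORT STEP 2 (E-fold tower): ZERO FIBRES (CARD-7 §5 S3, crit-1 PORT NOTE N3, PORT-SPEC S3/N3)
# (cell `qec`, experiment CDX, seat qec-cdx-type-1; twin of `Census.FoldLift` zero-word facts)

A big word with fold `0` is the DOUBLE `doubleK c = embWK c ⊕ parWK c` of its section part, of weight `2·|c|`
(`eq_doubleK_of_foldWK_eq_zero`, `popc_doubleK`); doubling commutes with translation (`doubleK_transWK`: big translation of
a double = double of the small translation).  Hence the fibre over the zero word is certified from a list `D` of small words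
COMPLETE UP TO TRANSLATION for the small words `c` of weight `≤ W/2` whose double lies in the big (extended) kernel
(`hD`), and one check per listed `c` — «double not in the kernel (V-filter, in kernel, N3), or the continuation passes on it»
(`hzeros`) — plus the property at the zero word itself: `goodFibK_zero`.  How `hD` is certified (orbit count / mini tower) is
the data files' business; this file fixes its statement.  Generic; no data; no `native_decide`.
-/

namespace Summit.Ventures.QEC.CircuitDistance.ETower

open Summit.Ventures.QEC.Census Summit.Ventures.QEC.Census.Fold

section Zero

variable {G : Geo} {nb : ℕ}

/-- A word with trivial fold is the double of its section part. -/
theorem eq_doubleK_of_foldWK_eq_zero (hG : OKK G nb) {w : ℕ} (hw : w < 2 ^ nK G nb) (h0 : foldWK G nb w = 0) :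
    w = doubleK G nb (aPartK G nb w) := by
  have hab : aPartK G nb w = bPartK G nb w := by
    have := foldWK_eq_parts (G := G) (nb := nb) w
    rw [h0] at this
    have h2 := congrArg (fun x => x ^^^ bPartK G nb w) this
    simp only [Nat.zero_xor, Nat.xor_assoc, Nat.xor_self, Nat.xor_zero] at h2
    exact h2.symm
  rw [doubleK]
  conv_lhs => rw [reconK hG hw]
  rw [hab]

/-- Weight of a double. -/
theorem popc_doubleK (hG : OKK G nb) (c : ℕ) : popc (nK G nb) (doubleK G nb c) = 2 * popc (nsK G nb) c := by
  rw [doubleK, popc_xor_of_and_eq_zero (embWK_and_parWK hG _ _), popc_embWK hG, popc_parWK hG]; ring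

/-- The section part of a double. -/
theorem foldWK_half_doubleK (hG : OKK G nb) {c : ℕ} (hc : c < 2 ^ nsK G nb) : aPartK G nb (doubleK G nb c) = c := by
  have h0 : foldWK G nb (doubleK G nb c) = 0 := foldWK_doubleK hG hc
  have heq := eq_doubleK_of_foldWK_eq_zero hG (doubleK_lt hG c) h0
  -- `doubleK` is injective on the window: compare section bits
  apply Nat.eq_of_testBit_eq
  intro j
  by_cases hj : j < nsK G nb
  · have h1 := testBit_emb_eqK hG (doubleK_lt hG c) hj (u := doubleK G nb c)
    rw [← h1, doubleK, Nat.testBit_xor]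
    have hpar : (parWK G nb c).testBit (G.emb j) = false := by
      rw [Bool.eq_false_iff]; intro h
      obtain ⟨j', hj', -, he⟩ := (testBit_parWK hG).1 h
      have := hG.fold_partner _ (hG.emb_lt j' hj')
      rw [he, hG.fold_emb j hj, hG.fold_emb j' hj'] at this
      subst this
      exact hG.partner_emb_ne _ hj' he
    rw [hpar, Bool.xor_false]
    rcases hb : c.testBit j with _ | _
    · rw [Bool.eq_false_iff]; intro h
      obtain ⟨j', hj', hb', he⟩ := (testBit_embWK hG).1 h
      have := emb_injK hG hj' hj he; subst this
      rw [hb] at hb'; exact Bool.false_ne_true hb'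
    · exact (testBit_embWK hG).2 ⟨j, hj, hb, rfl⟩
  · rw [not_lt] at hj
    have h1 : (aPartK G nb (doubleK G nb c)).testBit j = false :=
      Nat.testBit_lt_two_pow (lt_of_lt_of_le (aPartK_lt hG _) (Nat.pow_le_pow_right (by norm_num) hj))
    have h2 : c.testBit j = false := Nat.testBit_lt_two_pow (lt_of_lt_of_le hc (Nat.pow_le_pow_right (by norm_num) hj))
    rw [h1, h2]

/-- Translations commute with the partner map. -/
theorem transIdx_partner (hS : G.Shape) (da db J : ℕ) :
    transIdx G.l G.m da db (G.partner J) = G.partner (transIdx G.l G.m da db J) := by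
  rw [partner_eq_transIdxK hS, partner_eq_transIdxK hS, transIdx_comp hS.l_pos hS.m_pos, transIdx_comp hS.l_pos hS.m_pos,
    Nat.add_comm da, Nat.add_comm db]

/-- A big translation moves the fibre pair of `j` onto the fibre pair of the small translate of `j`. -/
theorem fibrePair_transIdx (hS : G.Shape) (hG : OKK G nb) (da db : ℕ) {j : ℕ} (hj : j < nsK G nb) :
    2 ^ transIdx G.l G.m da db (G.emb j) ^^^ 2 ^ transIdx G.l G.m da db (G.partner (G.emb j)) =
      2 ^ G.emb (transIdx G.ls G.ms da db j) ^^^ 2 ^ G.partner (G.emb (transIdx G.ls G.ms da db j)) := by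
  have hl := hS.l_pos
  have hm := hS.m_pos
  set J := transIdx G.l G.m da db (G.emb j) with hJ
  have hJlt : J < nK G nb := transIdx_ltK hl hm nb da db (hG.emb_lt j hj)
  have hfold : G.foldIdx J = transIdx G.ls G.ms da db j := by
    rw [hJ, foldIdx_transIdxK hS, hG.fold_emb j hj]
  have hP : transIdx G.l G.m da db (G.partner (G.emb j)) = G.partner J := by rw [hJ, transIdx_partner hS]
  rw [hP]
  rcases hG.cover J hJlt with h | h
  · rw [hfold] at h; rw [← h]
  · rw [hfold] at h
    rw [← h, hG.partner_partner _ (hG.emb_lt _ (by rw [← hfold]; exact hG.foldIdx_lt J hJlt)), Nat.xor_comm]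

/-- **Doubling commutes with translation**: the big translate of a double is the double of the small translate. -/
theorem doubleK_transWK (hS : G.Shape) (hG : OKK G nb) (da db c : ℕ) :
    transWK G.l G.m nb da db (doubleK G nb c) = doubleK G nb (transWK G.ls G.ms nb da db c) := by
  have hl := hS.l_pos
  have hm := hS.m_pos
  -- both sides are linear in `c`; compare on the basis
  have eL : transWK G.l G.m nb da db (doubleK G nb c) =
      lin (fun j => 2 ^ transIdx G.l G.m da db (G.emb j) ^^^ 2 ^ transIdx G.l G.m da db (G.partner (G.emb j)))
        (nsK G nb) 0 c := by
    rw [doubleK, embWK, parWK, ← lin_xor_fun, map_lin_of_xor (transWK G.l G.m nb da db) (lin_zero _ _ _) (transWK_xor _ _ _)]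
    exact lin_congr (i0 := 0) (fun j hj => by
      rw [Nat.zero_add, transWK_xor, transWK_two_pow _ _ _ (hG.emb_lt j hj),
        transWK_two_pow _ _ _ (hG.partner_lt _ (hG.emb_lt j hj))]) c
  have eR : doubleK G nb (transWK G.ls G.ms nb da db c) =
      lin (fun j => 2 ^ G.emb (transIdx G.ls G.ms da db j) ^^^ 2 ^ G.partner (G.emb (transIdx G.ls G.ms da db j)))
        (nsK G nb) 0 c := by
    rw [transWK, map_lin_of_xor (doubleK G nb) (by simp [doubleK]) (doubleK_xor G nb)]
    exact lin_congr (i0 := 0) (fun j hj => by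
      rw [Nat.zero_add, doubleK, embWK_two_pow (transIdx_ltK hS.ls_pos hS.ms_pos nb da db hj),
        parWK_two_pow (transIdx_ltK hS.ls_pos hS.ms_pos nb da db hj)]) c
  rw [eL, eR]
  exact lin_congr (i0 := 0) (fun j hj => by rw [Nat.zero_add]; exact fibrePair_transIdx hS hG da db hj) c

/-- **ZERO FIBRE from a complete-up-to-translation list of small half-words.**  `D` lists small words; `hD`: every small word
`c` of weight `≤ W / 2` whose double lies in the big kernel is `0` or a translate of a listed one; `hzeros`: for every listed
`c`, if its double lies in the kernel then `Q` holds on it; `hQ0 : Q 0`; `Q` closed under un-translating; kernel translation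
invariant.  Then `GoodFibK G nb col W Q 0`. -/
theorem goodFibK_zero (hS : G.Shape) (hG : OKK G nb) {col : ℕ → ℕ}
    (hK : ∀ da db u, u < 2 ^ nK G nb → (kerK col (nK G nb) u ↔ kerK col (nK G nb) (transWK G.l G.m nb da db u)))
    {W : ℕ} {Q : ℕ → Prop} (hQ : ∀ da db u, Q (transWK G.l G.m nb da db u) → Q u) (hQ0 : Q 0) (D : List ℕ)
    (hD : ∀ c, c < 2 ^ nsK G nb → 2 * popc (nsK G nb) c ≤ W → kerK col (nK G nb) (doubleK G nb c) →
      c = 0 ∨ MatchedK G.ls G.ms nb D c)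
    (hzeros : ∀ c ∈ D, kerK col (nK G nb) (doubleK G nb c) → Q (doubleK G nb c)) :
    GoodFibK G nb col W Q 0 := by
  intro u hu hker hwt hfold
  have heq := eq_doubleK_of_foldWK_eq_zero hG hu hfold
  set c := aPartK G nb u with hc
  have hclt : c < 2 ^ nsK G nb := aPartK_lt hG u
  have hw2 : 2 * popc (nsK G nb) c ≤ W := by rw [← popc_doubleK hG c, ← heq]; exact hwt
  have hkc : kerK col (nK G nb) (doubleK G nb c) := by rw [← heq]; exact hker
  rcases hD c hclt hw2 hkc with h0 | ⟨r, hr, da, db, htr⟩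
  · rw [heq, h0, doubleK, embWK_zero, parWK_zero, Nat.xor_zero]; exact hQ0
  · have hdr : doubleK G nb r = transWK G.l G.m nb da db u := by rw [← htr, ← doubleK_transWK hS hG, ← heq]
    have hkr : kerK col (nK G nb) (doubleK G nb r) := by rw [hdr]; exact (hK da db u hu).1 hker
    exact hQ da db u (hdr ▸ hzeros r hr hkr)


/-- The syndrome of a double is the FIBRE-TABLE syndrome of its half: `col·(doubleK c) = ⊕_{j ∈ c} (col (emb j) ⊕ col (partner (emb j)))`. -/
theorem lin_col_doubleK (hG : OKK G nb) (col : ℕ → ℕ) (c : ℕ) :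
    lin col (nK G nb) 0 (doubleK G nb c) = lin (fun j => col (G.emb j) ^^^ col (G.partner (G.emb j))) (nsK G nb) 0 c := by
  rw [doubleK, lin_xor, lin_col_embWK hG, lin_col_parWK hG, ← lin_xor_fun]

/-- **A double lies in the big kernel iff its half lies in the kernel of the fibre table** `M j = col (emb j) ⊕ col (partner (emb j))`
(so the zero-fibre D-lists are lists of low-weight kernel words of the step's fibre table `M`, up to translation). -/
theorem kerK_doubleK_iff (hG : OKK G nb) {col M : ℕ → ℕ}
    (hM : ∀ j, j < nsK G nb → M j = col (G.emb j) ^^^ col (G.partner (G.emb j))) (c : ℕ) :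
    kerK col (nK G nb) (doubleK G nb c) ↔ kerK M (nsK G nb) c := by
  unfold kerK
  rw [lin_col_doubleK hG, lin_congr (i0 := 0) (h := M) (fun j hj => by rw [Nat.zero_add, hM j hj])]

end Zero

end Summit.Ventures.QEC.CircuitDistance.ETower
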